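import Summits.HodgeConjecture.HodgeConjecture.Theorems.TropicalWeilObstructionTropicalWeilVanishingClassPositivityCertRun
import Summits.HodgeConjecture.HodgeConjecture.Theorems.TropicalWeilObstructionTropicalWeilVanishingClassPositivitySound
import Summits.HodgeConjecture.HodgeConjecture.Theorems.TropicalWeilObstructionTropicalWeilVanishingCalibrationCone
import HarnessLib

/-!
# Crux `TropicalWeilVanishing` (K1 of route `TropicalWeilObstruction`, stmt-HodgeConjecture-18478):
# class positivity is exhausted by the calibration cone — `κ = 8`, kernel form

Route `HodgeConjecture/TropicalWeilObstruction` is a REFUTATION route (Kontsevich's tropical test, negative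
branch); this file is negation-sink bookkeeping of the cell `pub-hodge-tropical` (seat tropical-1) and
decides nothing about the Hodge conjecture, in either direction, and nothing about the OPEN crux K1
(`TropicalWeilVanishing`, stmt-HodgeConjecture-18478).

K1 says that on a very general principally polarised tropical Weil eightfold every effective tropical
`4`-cycle has `W(Z) = 0`, equivalently (K3) `cyc Z ∈ ℚ θ₄(Q)`. What positivity of the weights gives toward
K1 is the calibration cone of `…TropicalWeilVanishingCalibrationCone` (seat tropical-2): effective classes
`q₀ θ₄ + q₁ Re w + q₂ Im w` satisfy `64 (q₁² + q₂²) ≤ q₀²`. This file records, as a theorem of the tree,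
that NO class-level positivity argument can do better (K1-SCOPE §4B (P)): the class of an effective
cycle is a positive combination `Σ_σ w_σ a_σ p_σ ⊗ p_σ` of squares of Plücker vectors of saturated
integer frames — the strongest positivity the certificate format `TropicalTorusCycle` provides about the
CLASS (it contains positive-semidefiniteness and `|W| ≤ μ`) — and the boundary ray of the cone is itself
such a combination:

* `boundaryRay_eq_sum_frameSquares` — at `Q = 1`,
  `24 · (8 · θ₄(1) + Re w(1)) = Σ_{j<206} n_j · p_{L_j} ⊗ p_{L_j}` as real bi-alternating functions on
  word pairs (the tree's class space), with `n_j ∈ ℕ₊` and saturated integer frames `L_j` (each with an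
  integer left inverse, so each `p_{L_j} ⊗ p_{L_j}` is, up to a positive factor, the class of a one-cell
  effective tropical chain); exact certificate of the seat's kit jobs j166135/j166405 re-checked by the
  kernel (`…CertData`, `…Checker`, `…CertRun`, `…Sound`);
* `nonneg_cyc_of_nonneg_frameSquares` — the linear functionals `≥ 0` on all saturated frame squares are
  `≥ 0` on `cyc Z` for every effective tropical `4`-cycle `Z` at every period (these are the class-level
  necessary conditions for effectivity); `nonneg_boundaryRay_of_nonneg_frameSquares` — dual form of the
  certificate: every such functional is `≥ 0` on `8 θ₄(1) + Re w(1)`;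
* `weilPairing_boundaryRay_eq_hermPairing` — that class lies ON the boundary of the calibration cone and
  OFF the theta line: `Ŵ(8 θ₄(1) + Re w(1)) = M̂(8 θ₄(1) + Re w(1)) ≠ 0` (tropical-2's `Ŵ(θ₄) = 0`,
  `Ŵ(Re w) = 8 det(P Q Pᴴ)`, `M̂(θ₄) = det(P Q Pᴴ)`, `M̂(Re w) = 0` at `Q = 1`).

So the calibration constant (`|q₁ - i q₂| ≤ q₀ / 8`, aperture `4^{1-n}` at `n = 4`) is attained by formal
effective classes at the standard period: a proof of K1 must use the balancing (`balanced`) and closing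
(`facet_eq`) conditions of the TYPE, not the class. The Weil-period and phase independence of the
statement (congruence by `⋀⁴h`, `hᵀh = Q` complex-linear; rotations `e^{tJ}`) and the a-priori gap between
decomposable sums of squares and positive-semidefiniteness on `Gr(4,8)` (Blekherman–Smith–Velasco) are
discussed in K1-SCOPE §4B (P) and are not formalised here. Weak, honest, not evidence for or against K1;
nothing about HC. No definition, no named fact, no sorry.

## References
* [Zharkov2020TropicalWeil] I. Zharkov, Tropical abelian varieties, Weil classes and the Hodge conjecture,
  arXiv:2002.02347, §2 (pp. 2–4).
* [MikhalkinZharkov2014Eigenwave] G. Mikhalkin, I. Zharkov, Tropical eigenwave and intermediate Jacobians,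
  Prop. 4.3.
* [BlekhermanSmithVelasco2016] G. Blekherman, G. G. Smith, M. Velasco, Sums of squares and varieties of
  minimal degree, J. Amer. Math. Soc. 29 (2016), Thm. 1.1.
-/

set_option linter.dupNamespace false

noncomputable section

open scoped BigOperators
open Matrix
open Literature.AlgebraicGeometry.Tropical
open Summit.HodgeConjecture.HodgeConjecture.Theorems.TropicalHodgeBound

namespace Summit.HodgeConjecture.HodgeConjecture.Theorems.TropicalWeilVanishing

namespace Kappa

/-! ## §0 Display-only notation (the K3 skeleton's local definitions, verbatim bodies; nothing is defined) -/

/-- `P = [1 | i·1]`, the `n × 2n` matrix of `dz₁ ∧ … ∧ dz_n`. -/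
local notation3 (prettyPrint := false) "𝐏⟦" n "⟧" =>
  (Matrix.of fun (k : Fin n) (a : Fin (2 * n)) =>
    (if (a : ℕ) = (k : ℕ) then (1 : ℂ) else 0) + (if (a : ℕ) = (k : ℕ) + n then Complex.I else 0))

/-- The skeleton's `dzCoord n S`. -/
local notation3 (prettyPrint := false) "dz⟦" n "⟧" S:max =>
  (Matrix.det (Matrix.of fun k a : Fin n =>
    (if (S a : ℕ) = (k : ℕ) then (1 : ℂ) else 0) + (if (S a : ℕ) = (k : ℕ) + n then Complex.I else 0)))

/-- The skeleton's `weilPairing n C` (the value `Ŵ(C)` of `dz ⊗ dz`). -/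
local notation3 (prettyPrint := false) "Ŵ⟦" n "⟧" C:max =>
  (∑ S : Fin n → Fin (2 * n), ∑ S' : Fin n → Fin (2 * n),
    dz⟦n⟧ S * dz⟦n⟧ S' / ((Nat.factorial n : ℂ) ^ 2) * ((C S S' : ℝ) : ℂ))

/-- The hermitian pairing `M̂(C)` (the value of `dz ⊗ dz̄` on `C`), as in `…HermitianPairing`. -/
local notation3 (prettyPrint := false) "M̂⟦" n "⟧" C:max =>
  (∑ S : Fin n → Fin (2 * n), ∑ S' : Fin n → Fin (2 * n),
    dz⟦n⟧ S * (starRingEnd ℂ) (dz⟦n⟧ S') / ((Nat.factorial n : ℂ) ^ 2) * ((C S S' : ℝ) : ℂ))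

/-- The skeleton's `thetaClass n Q`. -/
local notation3 (prettyPrint := false) "θ⟦" n "⟧" Q:max =>
  (fun S S' : Fin n → Fin (2 * n) => Matrix.det (Matrix.submatrix Q S S'))

/-- The skeleton's `omegaFrame n` (`Ω = Pᴴ`). -/
local notation3 (prettyPrint := false) "Ω⟦" n "⟧" =>
  (Matrix.of fun (a : Fin (2 * n)) (b : Fin n) =>
    (if (a : ℕ) = (b : ℕ) then (1 : ℂ) else 0) - (if (a : ℕ) = (b : ℕ) + n then Complex.I else 0))

/-- The skeleton's `weilClassC n Q` (`w(Q) = (⋀ⁿQ ⊗ 1)(Ω ⊗ Ω)`). -/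
local notation3 (prettyPrint := false) "wC⟦" n "⟧" Q:max =>
  (fun S S' : Fin n → Fin (2 * n) =>
    Matrix.det (Matrix.submatrix (Matrix.map Q ((↑) : ℝ → ℂ) * Ω⟦n⟧) S id) *
      Matrix.det (Matrix.submatrix (Ω⟦n⟧) S' id))

/-- The skeleton's `weilClassRe n Q` (`w₁ = Re w`). -/
local notation3 (prettyPrint := false) "wRe⟦" n "⟧" Q:max =>
  (fun S S' : Fin n → Fin (2 * n) => Complex.re ((wC⟦n⟧ Q) S S'))

/-! ### The boundary ray of the calibration cone is a sum of frame squares (real form, K3's notation) -/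

/-- The Plücker columns of all ranks `r < 70`, from the four kernel-run chunks. [folklore] -/
theorem col_all (r : ℕ) (hr : r < 70) (t : ℕ) (ht : t < 206) :
    cdig (colCode.getD r 0) t = plkD (frameCode.getD t 0) (wordCode.getD r 0) := by
  rcases (by omega : r < 18 ∨ (18 ≤ r ∧ r < 36) ∨ (36 ≤ r ∧ r < 54) ∨ 54 ≤ r) with h | h | h | h
  · exact col_of_checkCols checkCols_ok₀ r (by omega) (by omega) hr t ht
  · exact col_of_checkCols checkCols_ok₁ r (by omega) (by omega) hr t ht
  · exact col_of_checkCols checkCols_ok₂ r (by omega) (by omega) hr t ht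
  · exact col_of_checkCols checkCols_ok₃ r (by omega) (by omega) hr t ht

/-- **Class positivity is exhausted by the calibration cone (`κ = 8`, kernel form).** At the standard
period `Q = 1` the boundary ray of the calibration cone `64 (q₁² + q₂²) ≤ q₀²` of
`effective_cyc_mem_calibrationCone` — the class `8 · θ₄(1) + Re w(1)`, coordinates `(q₀, q₁, q₂) = (8, 1, 0)`
— is, up to the factor `24`, a positive INTEGRAL combination of `206` squares `p_L ⊗ p_L` of Plücker
vectors of SATURATED integer `8 × 4` frames `L` (each admits an integer left inverse, so each is a legal
cell frame of a `TropicalTorusCycle`, and `p_L ⊗ p_L` is, up to a positive factor, the class `cyc` of a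
one-cell effective tropical chain):
`24 · (8 · θ₄(1) + Re w(1)) = Σ_{j<206} n_j · p_{L_j} ⊗ p_{L_j}`, `n_j ∈ {192, 96, 176, 4, 8, 1}`.
So no constraint on tropical cycle classes that uses only "the class is a positive combination of
frame squares" (the strongest class-level positivity the certificate format provides, containing
positive-semidefiniteness and the calibration inequality `|W| ≤ μ`) can narrow the calibration cone, let
alone prove K1; a proof of K1 must use the balancing and closing conditions of the TYPE. The six frame
orbits are the calibrated ones (`η² ∈ ℝ_{≥0}·1`): complex coordinate `2`-planes, planes through one
complex line, special Lagrangian planes. Exact certificate of the seat's kit jobs j166135/j166405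
(K1-SCOPE §4B (P)); decides nothing about K1 or HC. [cite: Zharkov2020TropicalWeil, §2]
[cite: MikhalkinZharkov2014Eigenwave, Prop. 4.3] [cite: BlekhermanSmithVelasco2016, Thm. 1.1] -/
theorem boundaryRay_eq_sum_frameSquares :
    ∃ (w : Fin 206 → ℕ) (L : Fin 206 → Matrix (Fin (2 * 4)) (Fin 4) ℤ),
      (∀ j, 0 < w j) ∧ (∀ j, ∃ M : Matrix (Fin 4) (Fin (2 * 4)) ℤ, M * L j = 1) ∧
      (24 : ℝ) • ((8 : ℝ) • θ⟦4⟧ (1 : Matrix (Fin (2 * 4)) (Fin (2 * 4)) ℝ) +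
          wRe⟦4⟧ (1 : Matrix (Fin (2 * 4)) (Fin (2 * 4)) ℝ)) =
        ∑ j, ((w j : ℕ) : ℝ) • fun S S' : Fin 4 → Fin (2 * 4) =>
          ((pluckerCoord (L j) S : ℤ) : ℝ) * ((pluckerCoord (L j) S' : ℤ) : ℝ) := by
  refine ⟨fun j => wt j, fun j => frameOf (frameCode.getD j 0),
    fun j => by show 0 < wt j; unfold wt; split_ifs <;> decide,
    fun j => ⟨invOf (invCode.getD j 0), invOf_mul_frameOf checkSat_ok j j.isLt⟩, ?_⟩
  funext S S'
  simp only [Pi.smul_apply, Pi.add_apply, Finset.sum_apply, smul_eq_mul]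
  -- the left-hand side in K3's integer coordinates
  have hmap : (1 : Matrix (Fin (2 * 4)) (Fin (2 * 4)) ℝ).map ((↑) : ℝ → ℂ) = 1 :=
    Matrix.map_one _ Complex.ofReal_zero Complex.ofReal_one
  have hθ : ((1 : Matrix (Fin (2 * 4)) (Fin (2 * 4)) ℝ).submatrix S S').det =
      ((Chk.thetaZ S S' : ℤ) : ℝ) := (thetaZ_cast S S').symm
  have hw : (((1 : Matrix (Fin (2 * 4)) (Fin (2 * 4)) ℝ).map ((↑) : ℝ → ℂ) * Ω⟦4⟧).submatrix S id).det
      * ((Ω⟦4⟧).submatrix S' id).det = GaussianInt.toComplex (Chk.wG S S') := by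
    rw [hmap, Matrix.one_mul, Chk.wG, map_mul, omegaMinorF_toComplex, omegaMinorF_toComplex]
  have hre : ((((1 : Matrix (Fin (2 * 4)) (Fin (2 * 4)) ℝ).map ((↑) : ℝ → ℂ) * Ω⟦4⟧).submatrix S
      id).det * ((Ω⟦4⟧).submatrix S' id).det).re = (((Chk.wG S S').re : ℤ) : ℝ) := by
    rw [hw, GaussianInt.intCast_re]
  rw [hθ, hre, Fin.sum_univ_eq_sum_range (fun t => ((wt t : ℕ) : ℝ) *
    ((((pluckerCoord (frameOf (frameCode.getD t 0)) S : ℤ) : ℝ)) *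
      ((pluckerCoord (frameOf (frameCode.getD t 0)) S' : ℤ) : ℝ))) 206]
  have hZ := sum_frameSquares_eq_classes checkSparse_ok checkGram_ok col_all S S'
  have hR : ((∑ t ∈ Finset.range 206, (wt t : ℤ) * pluckerCoord (frameOf (frameCode.getD t 0)) S *
      pluckerCoord (frameOf (frameCode.getD t 0)) S' : ℤ) : ℝ) =
      ((24 * (8 * Chk.thetaZ S S' + (Chk.wG S S').re) : ℤ) : ℝ) := by rw [hZ]
  push_cast at hR
  rw [← hR]
  exact Finset.sum_congr rfl fun t _ => by ring

/-- **Class-positivity constraints are exactly the linear functionals non-negative on frame squares:**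
such a functional is non-negative on the class `cyc Z` of EVERY effective tropical `4`-cycle `Z` on EVERY
`ℝ⁸/Qℤ⁸` (`cyc Z = Σ_σ w_σ a_σ · p_σ ⊗ p_σ` with `w_σ > 0`, `a_σ > 0` and saturated frames — the only
positivity the certificate format carries about the class). [cite: MikhalkinZharkov2014Eigenwave, Prop. 4.3] -/
theorem nonneg_cyc_of_nonneg_frameSquares
    (Φ : ((Fin 4 → Fin (2 * 4)) → (Fin 4 → Fin (2 * 4)) → ℝ) →ₗ[ℝ] ℝ)
    (hΦ : ∀ L : Matrix (Fin (2 * 4)) (Fin 4) ℤ, (∃ M : Matrix (Fin 4) (Fin (2 * 4)) ℤ, M * L = 1) →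
      0 ≤ Φ (fun S S' => ((pluckerCoord L S : ℤ) : ℝ) * ((pluckerCoord L S' : ℤ) : ℝ)))
    {Q : Matrix (Fin (2 * 4)) (Fin (2 * 4)) ℝ} (Z : TropicalTorusCycle (2 * 4) 4 Q) :
    0 ≤ Φ (TropicalTorusCycle.cyc Z) := by
  have hcyc : TropicalTorusCycle.cyc Z = ∑ σ, (((Z.cell σ).weight : ℝ) * (Z.cell σ).latticeVolume) •
      fun S S' : Fin 4 → Fin (2 * 4) =>
        ((pluckerCoord (Z.cell σ).frame S : ℤ) : ℝ) * ((pluckerCoord (Z.cell σ).frame S' : ℤ) : ℝ) := by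
    funext S S'
    simp only [TropicalTorusCycle.cyc, Finset.sum_apply, Pi.smul_apply, smul_eq_mul]
    exact Finset.sum_congr rfl fun σ _ => by ring
  rw [hcyc, map_sum]
  refine Finset.sum_nonneg fun σ _ => ?_
  rw [map_smul, smul_eq_mul]
  exact mul_nonneg (mul_nonneg (Nat.cast_nonneg _) (latticeVolume_pos _).le)
    (hΦ _ (Z.cell σ).frame_saturated)

/-- **Dual form: no class-positivity constraint separates the boundary ray.** Every ℝ-linear functional
on the class space that is non-negative on every square `p_L ⊗ p_L` of the Plücker vector of a saturated
integer frame `L` (by `nonneg_cyc_of_nonneg_frameSquares`: every linear class-level necessary condition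
for effectivity, at every period) is non-negative on `8 · θ₄(1) + Re w(1)`, a class with `W ≠ 0` on the
boundary of the calibration cone — so no such condition proves K1 or narrows the cone.
[cite: Zharkov2020TropicalWeil, §2] -/
theorem nonneg_boundaryRay_of_nonneg_frameSquares
    (Φ : ((Fin 4 → Fin (2 * 4)) → (Fin 4 → Fin (2 * 4)) → ℝ) →ₗ[ℝ] ℝ)
    (hΦ : ∀ L : Matrix (Fin (2 * 4)) (Fin 4) ℤ, (∃ M : Matrix (Fin 4) (Fin (2 * 4)) ℤ, M * L = 1) →
      0 ≤ Φ (fun S S' => ((pluckerCoord L S : ℤ) : ℝ) * ((pluckerCoord L S' : ℤ) : ℝ))) :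
    0 ≤ Φ ((8 : ℝ) • θ⟦4⟧ (1 : Matrix (Fin (2 * 4)) (Fin (2 * 4)) ℝ) +
      wRe⟦4⟧ (1 : Matrix (Fin (2 * 4)) (Fin (2 * 4)) ℝ)) := by
  obtain ⟨w, L, -, hL, hid⟩ := boundaryRay_eq_sum_frameSquares
  have h24 := congrArg Φ hid
  rw [map_smul, map_sum, smul_eq_mul] at h24
  have hnn : 0 ≤ ∑ j, Φ (((w j : ℕ) : ℝ) • fun S S' : Fin 4 → Fin (2 * 4) =>
      ((pluckerCoord (L j) S : ℤ) : ℝ) * ((pluckerCoord (L j) S' : ℤ) : ℝ)) :=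
    Finset.sum_nonneg fun j _ => by
      rw [map_smul, smul_eq_mul]
      exact mul_nonneg (Nat.cast_nonneg _) (hΦ (L j) (hL j))
  rw [← h24] at hnn
  linarith

/-- `Ŵ` on a combination `a • A + B` (kernel form of linearity). [folklore] -/
theorem weilPairing_smul_add (a : ℝ) (A B : (Fin 4 → Fin (2 * 4)) → (Fin 4 → Fin (2 * 4)) → ℝ) :
    Ŵ⟦4⟧ (a • A + B) = (a : ℂ) * Ŵ⟦4⟧ A + Ŵ⟦4⟧ B := by
  simp only [Pi.add_apply, Pi.smul_apply, smul_eq_mul, Complex.ofReal_add, Complex.ofReal_mul,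
    mul_add, Finset.sum_add_distrib, Finset.mul_sum]
  congr 1
  refine Finset.sum_congr rfl fun S _ => Finset.sum_congr rfl fun S' _ => ?_
  ring

/-- `M̂` on a combination `a • A + B` (kernel form of linearity). [folklore] -/
theorem hermPairing_smul_add (a : ℝ) (A B : (Fin 4 → Fin (2 * 4)) → (Fin 4 → Fin (2 * 4)) → ℝ) :
    M̂⟦4⟧ (a • A + B) = (a : ℂ) * M̂⟦4⟧ A + M̂⟦4⟧ B := by
  simp only [Pi.add_apply, Pi.smul_apply, smul_eq_mul, Complex.ofReal_add, Complex.ofReal_mul,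
    mul_add, Finset.sum_add_distrib, Finset.mul_sum]
  congr 1
  refine Finset.sum_congr rfl fun S _ => Finset.sum_congr rfl fun S' _ => ?_
  ring

/-- **The certified class sits ON the boundary of the calibration cone and OFF the theta line:**
`Ŵ(8 θ₄(1) + Re w(1)) = M̂(8 θ₄(1) + Re w(1)) ≠ 0` — equality in the calibration inequality `|Ŵ| ≤ M̂`
(sibling files `…HermitianPairing`, `…CalibrationCone`: `Ŵ(θ₄) = 0`, `Ŵ(Re w) = 8 det(P Pᴴ)`,
`M̂(θ₄) = det(P Pᴴ)`, `M̂(Re w) = 0`), with non-zero Weil functional. Together with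
`boundaryRay_eq_sum_frameSquares`: the calibration constant `64 = 8²` is attained by formal effective
classes, i.e. it is sharp among all class-level constraints. [cite: Zharkov2020TropicalWeil, §2] -/
theorem weilPairing_boundaryRay_eq_hermPairing :
    Ŵ⟦4⟧ ((8 : ℝ) • θ⟦4⟧ (1 : Matrix (Fin (2 * 4)) (Fin (2 * 4)) ℝ) +
        wRe⟦4⟧ (1 : Matrix (Fin (2 * 4)) (Fin (2 * 4)) ℝ)) =
      M̂⟦4⟧ ((8 : ℝ) • θ⟦4⟧ (1 : Matrix (Fin (2 * 4)) (Fin (2 * 4)) ℝ) +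
        wRe⟦4⟧ (1 : Matrix (Fin (2 * 4)) (Fin (2 * 4)) ℝ)) ∧
    Ŵ⟦4⟧ ((8 : ℝ) • θ⟦4⟧ (1 : Matrix (Fin (2 * 4)) (Fin (2 * 4)) ℝ) +
        wRe⟦4⟧ (1 : Matrix (Fin (2 * 4)) (Fin (2 * 4)) ℝ)) ≠ 0 := by
  have h4 : (0 : ℕ) < 4 := by norm_num
  have hJ : (1 : Matrix (Fin (2 * 4)) (Fin (2 * 4)) ℝ) * weilJ 4 = weilJ 4 * 1 := by
    rw [Matrix.one_mul, Matrix.mul_one]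
  obtain ⟨hDre, -⟩ := det_frame_mul_map_mul_conjTranspose_pos
    (1 : Matrix (Fin (2 * 4)) (Fin (2 * 4)) ℝ) Matrix.PosDef.one
  have hW : Ŵ⟦4⟧ ((8 : ℝ) • θ⟦4⟧ (1 : Matrix (Fin (2 * 4)) (Fin (2 * 4)) ℝ) +
      wRe⟦4⟧ (1 : Matrix (Fin (2 * 4)) (Fin (2 * 4)) ℝ)) =
      8 * (𝐏⟦4⟧ * (1 : Matrix (Fin (2 * 4)) (Fin (2 * 4)) ℝ).map ((↑) : ℝ → ℂ) * (𝐏⟦4⟧)ᴴ).det := by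
    rw [weilPairing_smul_add, weilPairing_thetaClass_eq_zero h4 _ hJ, weilPairing_weilClassRe_eq h4]
    norm_num
  have hM : M̂⟦4⟧ ((8 : ℝ) • θ⟦4⟧ (1 : Matrix (Fin (2 * 4)) (Fin (2 * 4)) ℝ) +
      wRe⟦4⟧ (1 : Matrix (Fin (2 * 4)) (Fin (2 * 4)) ℝ)) =
      8 * (𝐏⟦4⟧ * (1 : Matrix (Fin (2 * 4)) (Fin (2 * 4)) ℝ).map ((↑) : ℝ → ℂ) * (𝐏⟦4⟧)ᴴ).det := by
    rw [hermPairing_smul_add, hermPairing_thetaClass_eq_det, hermPairing_weilClassRe_eq_zero h4 _ hJ]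
    push_cast
    ring
  refine ⟨hW.trans hM.symm, ?_⟩
  rw [hW]
  refine mul_ne_zero (by norm_num) fun h0 => ?_
  rw [h0, Complex.zero_re] at hDre
  exact lt_irrefl _ hDre

end Kappa

end Summit.HodgeConjecture.HodgeConjecture.Theorems.TropicalWeilVanishing

end
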